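import Summits.SmoothPoincare4.SmoothPoincare4.Theorems.CongruenceShadowsAgkCor6SufficiencyGeomMarkingDefs
import Literature.Topology.FourManifolds.TrisectionFunctorGKCentralSurface
import Mathlib.Geometry.Manifold.Instances.Sphere

/-!
# Stub `stub_cellBasisGenusZero` of line `lp-by-sphere-system-surgery` for crux `AgkCor6Sufficiency`
(item stmt-SmoothPoincare4-10894, routes `CongruenceShadows` / `GroupTrisection`; lead reshape r6b)

Genus `0`: for a balanced `(0, k)` Gay–Kirby trisection the central surface `F = ⋂ₘ Sₘ` is a
`2`-sphere (`F = f(∂H)`, `H ≅ 𝔻³` by clause (iii) and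
`HasHandleDecomposition.nonempty_diffeomorph_closedBall_of_handleCount_one_zero`, `∂𝔻³ = S²` by
`boundary_closedBall`), so `F` minus any point is simply connected (stereographic projection,
`isSimplyConnected_compl_singleton_sphere`); the tree's genus-`0` datum
`exists_datum_genus_zero_of_cell` then yields the cell basis `CellBasis F Φ 0` of every
chart-like `2`-cell `Φ` in `F` (path-connectedness of `F ∖ Φ(B(0,1))`, a generator `t` of `π₁`
of the boundary circle, and the trivial free basis `θ : F⟨∅⟩ ≃* π₁(F ∖ Φ(B(0,1)), Φ(1,0)) = 1`
with `θ(r_0) = t`).  No `sorry`.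
-/

set_option linter.dupNamespace false

noncomputable section

open Set Function ContinuousMap Metric
open scoped Manifold ContDiff Topology

namespace Summit.SmoothPoincare4.SmoothPoincare4.Cruxes.AgkCor6Sufficiency.LpBySphereSystemSurgery

open Literature.Topology.FourManifolds
open Literature.AlgebraicTopology.FundamentalGroup
open Literature.AlgebraicTopology.FundamentalGroup.VanKampen
open Literature.AlgebraicTopology.Homotopy

/-- `S² ∖ {q}` is simply connected, read in `ℝ³` (stereographic projection from `q`,
Hatcher Prop. 1.14; the tree's `isSimplyConnected_compl_singleton_sphere` pushed along
`Subtype.val`). -/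
private theorem isSimplyConnected_sphere_diff_singleton {q : EuclideanSpace ℝ (Fin 3)}
    (hq : q ∈ Metric.sphere (0 : EuclideanSpace ℝ (Fin 3)) 1) :
    IsSimplyConnected (Metric.sphere (0 : EuclideanSpace ℝ (Fin 3)) 1 \ {q}) := by
  have h := Literature.AlgebraicTopology.FundamentalGroup.isSimplyConnected_compl_singleton_sphere
    (E := EuclideanSpace ℝ (Fin 3)) ⟨q, hq⟩
  rw [← Topology.IsEmbedding.subtypeVal.isSimplyConnected_image] at h
  have hset : Subtype.val '' ({⟨q, hq⟩}ᶜ : Set (Metric.sphere (0 : EuclideanSpace ℝ (Fin 3)) 1)) =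
      Metric.sphere (0 : EuclideanSpace ℝ (Fin 3)) 1 \ {q} := by
    refine Set.ext fun y => ⟨?_, ?_⟩
    · rintro ⟨w, hw, rfl⟩
      exact ⟨w.2, fun h => hw (Subtype.ext h)⟩
    · rintro ⟨hy, hyq⟩
      exact ⟨⟨y, hy⟩, fun h => hyq (congrArg Subtype.val h), rfl⟩
  rwa [hset] at h

/-- **Genus `0`: the central surface minus a point is simply connected.**  For a
`(0; k₀, k₁, k₂)`-trisection the handlebody `H = H₀₁` of clause (iii) is a closed `3`-ball
(`HasHandleDecomposition.nonempty_diffeomorph_closedBall_of_handleCount_one_zero`), so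
`F = f(∂H) ≅ ∂𝔻³ = S²` (`Diffeomorph.image_boundary`, `boundary_closedBall`) and `F ∖ {p}` is the
homeomorphic image of `S²` minus a point, simply connected by stereographic projection
(pattern of `IsGKTrisection.isSimplyConnected_iInter_of_genus_zero`). -/
private theorem isSimplyConnected_iInter_diff_singleton_of_genus_zero {X : Type}
    [TopologicalSpace X] [T2Space X] [ChartedSpace (EuclideanSpace ℝ (Fin 4)) X]
    {k : Fin 3 → ℕ} {S : Fin 3 → Set X} (h : IsGKTrisection X 0 k S) {p : X}
    (hp : p ∈ ⋂ l, S l) : IsSimplyConnected ((⋂ l, S l) \ {p}) := by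
  obtain ⟨H, _, _, f, hM, hH, hc, hh, hf, -, hbdry⟩ := h.2.2 0 1 (by decide)
  haveI := hM
  haveI := hH
  haveI := hc
  haveI : T2Space H := hf.isEmbedding.t2Space
  obtain ⟨Ψ⟩ := hh.nonempty_diffeomorph_closedBall_of_handleCount_one_zero (by norm_num)
  -- `p = f q` with `q ∈ ∂H`
  rw [← hbdry] at hp
  obtain ⟨q, hq, rfl⟩ := hp
  -- `Ψ q ∈ ∂𝔻³`, i.e. `‖Ψ q‖ = 1`
  have hΨq : ‖((Ψ q : Metric.closedBall (0 : EuclideanSpace ℝ (Fin 3)) 1) :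
      EuclideanSpace ℝ (Fin 3))‖ = 1 := by
    have hmem : Ψ q ∈ (𝓡∂ 3).boundary (Metric.closedBall (0 : EuclideanSpace ℝ (Fin 3)) 1) := by
      rw [← Ψ.image_boundary (by simp)]
      exact mem_image_of_mem _ hq
    rw [boundary_closedBall] at hmem
    exact hmem
  -- `∂𝔻³` read in `ℝ³` is the unit sphere
  have hval : Subtype.val '' (𝓡∂ 3).boundary (Metric.closedBall (0 : EuclideanSpace ℝ (Fin 3)) 1)
      = Metric.sphere (0 : EuclideanSpace ℝ (Fin 3)) 1 := by
    rw [boundary_closedBall]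
    ext y
    simp only [mem_image, mem_setOf_eq, Metric.mem_sphere, dist_zero_right]
    constructor
    · rintro ⟨x, hx, rfl⟩
      exact hx
    · intro hy
      exact ⟨⟨y, Metric.mem_closedBall.2 (by rw [dist_zero_right]; exact hy.le)⟩, hy, rfl⟩
  -- transport `S² ∖ {Ψ q}` back along `Subtype.val`, `Ψ`, `f`
  rw [← hbdry, ← image_singleton, ← image_sdiff hf.isEmbedding.injective,
    hf.isEmbedding.isSimplyConnected_image, ← Ψ.toHomeomorph.isSimplyConnected_image,
    image_sdiff Ψ.toHomeomorph.injective, image_singleton,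
    ← Topology.IsEmbedding.subtypeVal.isSimplyConnected_image,
    image_sdiff Subtype.val_injective, image_singleton]
  change IsSimplyConnected
    (Subtype.val '' (Ψ '' (𝓡∂ 3).boundary H) \ {((Ψ q : Metric.closedBall _ 1) : EuclideanSpace ℝ (Fin 3))})
  rw [Ψ.image_boundary (by simp), hval]
  exact isSimplyConnected_sphere_diff_singleton (by simpa using hΨq)

/-- **Stub `stub_cellBasisGenusZero` (genus `0` cell basis).**  For a balanced `(0, k)`
Gay–Kirby trisection of a closed connected oriented smooth `4`-manifold `X` and any chart-like
`2`-cell `Φ` in the central surface `F = ⋂ₘ Sₘ ≅ S²`: `F ∖ Φ(B(0,1))` is path connected and carries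
the trivial genus-`0` cell basis (`π₁(F ∖ Φ(B(0,1)), Φ(1,0)) = 1 ≅ F⟨∅⟩`, the boundary circle
reading `r_0 = 1`), from `exists_datum_genus_zero_of_cell` and
`isSimplyConnected_iInter_diff_singleton_of_genus_zero`. -/
theorem stub_cellBasisGenusZero : ∀ (X : Type) [TopologicalSpace X] [T2Space X]
    [SecondCountableTopology X] [ChartedSpace (EuclideanSpace ℝ (Fin 4)) X] [IsManifold (𝓡 4) ∞ X]
    [CompactSpace X] [ConnectedSpace X] (o : SmoothOrientation (𝓡 4) X) (k : ℕ) (S : Fin 3 → Set X)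
    (h : IsBalancedGKTrisection X 0 k S) (Φ : C(closedBall (0 : EuclideanSpace ℝ (Fin 2)) 2, X))
    (O : Set X) (hc : IsChartCell (⋂ m, S m) Φ O), CellBasis (⋂ m, S m) Φ 0 := by
  intro X _ _ _ _ _ _ _ _ k S h Φ O hc
  obtain ⟨hinj, hΦF, hO, hFO⟩ := hc
  have hF : IsClosed (⋂ m, S m) := h.isGKTrisection.isCompact_iInter.isClosed
  have hF0 : IsSimplyConnected ((⋂ m, S m) \ {Φ ⟨0, by simp⟩}) :=
    isSimplyConnected_iInter_diff_singleton_of_genus_zero h.isGKTrisection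
      (hΦF (mem_range_self _))
  have hx : Φ cellPt ∈ cellCircle Φ :=
    ⟨cellPt, by simp [cellPt], rfl⟩
  obtain ⟨-, hCA, -, -, -, -, hApc, -, -, -, t, θA, ht, hθA, -⟩ :=
    exists_datum_genus_zero_of_cell hF Φ hinj hΦF hO hFO hF0 hx
  exact ⟨hApc, hx, hCA, t, θA, ht, hθA⟩

end Summit.SmoothPoincare4.SmoothPoincare4.Cruxes.AgkCor6Sufficiency.LpBySphereSystemSurgery

end
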